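import Literature.NumberTheory.Automorphic.QuaternionIdealLocallyPrincipal
import Literature.NumberTheory.Automorphic.BrandtOrderIdeals
import Literature.NumberTheory.Automorphic.BrandtModuleDictionary
import Literature.NumberTheory.Automorphic.BrandtModuleChains
import HarnessLib

/-!
# The Brandt data of connected orders agree: transport along `J ↦ (J : I)_ℓ = J I⁻¹`
# (Vignéras, LNM 800, Ch. III §5 B–C; Eichler 1973, II §6: the Brandt matrices of an order
# depend only on its genus)

Topic `NumberTheory/Automorphic`; theorems only (no definition, no named fact, no instance).
Let `O` be a `ℤ`-order in a division quaternion algebra `B` over `ℚ`, `I` an invertible right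
`O`-ideal and `O' = O_ℓ(I)` its left order — an order *connected* to `O` ("lié", Vignéras I §4:
`O_g(I)` and `O_d(I)` are linked by `I`; the orders connected to `O` are exactly those locally
conjugate to it, since `O'_(q) = α_q O_(q) α_q⁻¹` when `I_(q) = α_q O_(q)`). Multiplication by
`I⁻¹` on the right, realised as the left transporter `J ↦ (J : I)_ℓ = {x : x I ⊆ J}`
(`transporterLeft I J`, Voight (26.5.7)), identifies the arithmetic of right `O`-ideals with that
of right `O'`-ideals:

* `isInvertibleRightIdeal_transporterLeft` — `(J : I)_ℓ` is an invertible right `O'`-ideal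
  (locally `(β α⁻¹) O'_(q)` when `J_(q) = β O_(q)`), with `(J : I)_ℓ I = J`
  (`transporterLeft_mul_eq`) and `((J' I) : I)_ℓ = J'` for invertible right `O'`-ideals `J'`
  (`transporterLeft_mul_self`, `IsInvertibleRightIdeal.mul_connecting`: `J' I` is an invertible
  right `O`-ideal);
* it commutes with translations (`transporterLeft_units_smul`: `(b J : I)_ℓ = b (J : I)_ℓ`),
  preserves inclusions and **indices** (`relIndex_transporterLeft`, prime by prime: locally it is
  right multiplication by `α_q⁻¹`) and **stabilisers** (`stabilizer_transporterLeft`);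
* hence classes correspond (`mk_transporterLeft_eq_iff`), the sub-ideal counts agree
  (`subidealCount_transporterLeft`), and there is a bijection of class sets
  `RightIdealClass O ≃ RightIdealClass O'` under which the weights and all Brandt matrices of
  `BrandtData.ofOrder O` and `BrandtData.ofOrder O'` correspond:
  **`BrandtData.ofOrder_transport`** — `∃ e : Cls O ≃ Cls O', w' (e i) = w i ∧
  B'(n) (e i) (e j) = B(n) i j`.

This is the global half of "the Brandt module of level `(N⁺, N⁻)` does not depend on the choice
of the Eichler order in its genus"; the local half is the local conjugacy of Eichler orders of
the same level (equality at the ramified primes, `MaximalOrderRamifiedPrime.lean`).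

## References

* M.-F. Vignéras, *Arithmétique des algèbres de quaternions*, LNM 800 (1980), Ch. I §4
  (ordres liés), Ch. III §5 B (classes d'idéaux) [VignerasLNM800].
* M. Eichler, LNM 320 (1973), Ch. II §6 [Eichler1973].
* J. Voight, *Quaternion Algebras*, GTM 288 (2021), 17.4, (26.5.7) [Voight2021].
-/

noncomputable section

open scoped Pointwise

universe u

namespace Literature.NumberTheory.Automorphic

variable {B : Type u} [Ring B]

/-! ### Translations and transporters -/

section General

/-- `(b J : I)_ℓ = b (J : I)_ℓ`. [folklore] -/
theorem transporterLeft_units_smul (I J : Submodule ℤ B) (b : Bˣ) :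
    transporterLeft I (b • J) = b • transporterLeft I J := by
  ext x
  rw [mem_units_smul_submodule_iff, mem_transporterLeft_iff, mem_transporterLeft_iff]
  refine forall₂_congr fun m _ => ?_
  rw [mem_units_smul_submodule_iff, Units.smul_def, Units.smul_def, smul_eq_mul, smul_eq_mul,
    mul_assoc]

/-- Left and right translations of a lattice commute: `b (N c) = (b N) c`. [folklore] -/
theorem units_smul_op_smul_comm (b : Bˣ) (c : B) (N : Submodule ℤ B) :
    b • (MulOpposite.op c • N) = MulOpposite.op c • (b • N) := by
  have key : ∀ n : B, b • (MulOpposite.op c • n) = MulOpposite.op c • (b • n) := fun n => by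
    simp only [Units.smul_def, MulOpposite.smul_eq_mul_unop, MulOpposite.unop_op, smul_eq_mul,
      mul_assoc]
  ext x
  constructor
  · intro hx
    obtain ⟨y, hy, rfl⟩ := (Submodule.mem_smul_pointwise_iff_exists x b _).mp hx
    obtain ⟨n, hn, rfl⟩ := (Submodule.mem_smul_pointwise_iff_exists y _ N).mp hy
    rw [key]
    exact Submodule.smul_mem_pointwise_smul _ _ _ (Submodule.smul_mem_pointwise_smul n b N hn)
  · intro hx
    obtain ⟨y, hy, rfl⟩ := (Submodule.mem_smul_pointwise_iff_exists x _ _).mp hx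
    obtain ⟨n, hn, rfl⟩ := (Submodule.mem_smul_pointwise_iff_exists y b N).mp hy
    rw [← key]
    exact Submodule.smul_mem_pointwise_smul _ b _ (Submodule.smul_mem_pointwise_smul n _ N hn)

/-- The left transporter of principal lattices: `(β Λ : α Λ)_ℓ = β Λ α⁻¹` for a multiplicatively
closed `Λ ∋ 1` with `O_ℓ(Λ) = Λ`. [folklore] -/
theorem transporterLeft_units_smul_units_smul {Λ : Submodule ℤ B} (h1 : (1 : B) ∈ Λ)
    (hmul : ∀ a ∈ Λ, ∀ b ∈ Λ, a * b ∈ Λ) (α β : Bˣ) :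
    transporterLeft (α • Λ) (β • Λ) = β • (MulOpposite.op ((α⁻¹ : Bˣ) : B) • Λ) := by
  ext x
  rw [mem_transporterLeft_iff, mem_units_smul_submodule_iff, mem_op_units_smul_submodule_iff, inv_inv]
  constructor
  · intro h
    -- `x α ∈ β Λ`, i.e. `β⁻¹ x α ∈ Λ`
    have hα : (α : B) ∈ α • Λ := by
      have h' := Submodule.smul_mem_pointwise_smul (1 : B) α Λ h1
      rwa [Units.smul_def, smul_eq_mul, mul_one] at h'
    have := h (α : B) hα
    rw [mem_units_smul_submodule_iff, Units.smul_def, smul_eq_mul] at this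
    rw [Units.smul_def, smul_eq_mul, mul_assoc]
    exact this
  · intro hx m hm
    obtain ⟨a, ha, rfl⟩ := (Submodule.mem_smul_pointwise_iff_exists m α Λ).mp hm
    rw [mem_units_smul_submodule_iff, Units.smul_def, Units.smul_def, smul_eq_mul, smul_eq_mul]
    rw [Units.smul_def, smul_eq_mul, mul_assoc] at hx
    -- `β⁻¹ x (α a) = (β⁻¹ x α) a ∈ Λ`
    have : ((β⁻¹ : Bˣ) : B) * (x * ((α : B) * a)) = (((β⁻¹ : Bˣ) : B) * (x * α)) * a := by
      simp only [mul_assoc]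
    rw [this]
    exact hmul _ hx a ha

/-- Products of principal lattices over connected local orders:
`(β' (α Λ α⁻¹)) (α Λ) = (β' α) Λ` for a multiplicatively closed `Λ` with `Λ Λ = Λ`. [folklore] -/
theorem units_smul_conj_mul_units_smul {Λ : Submodule ℤ B} (hΛΛ : Λ * Λ = Λ) (α β' : Bˣ) :
    (β' • (α • (MulOpposite.op ((α⁻¹ : Bˣ) : B) • Λ))) * (α • Λ) = (β' * α) • Λ := by
  rw [smul_mul_assoc, smul_mul_assoc, op_smul_mul_eq_mul_smul, ← units_smul_submodule_eq,
    inv_smul_smul, hΛΛ, mul_smul]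

end General

/-! ### The transport `J ↦ (J : I)_ℓ` for an invertible right ideal `I` -/

section Transport

variable [Algebra ℚ B] [IsQuaternionAlgebra ℚ B]
variable (hdiv : ∀ x : B, x ≠ 0 → IsUnit x) {O : Submodule ℤ B} (hO : IsZOrder O)
variable {I : Submodule ℤ B} (hI : IsInvertibleRightIdeal O I)
include hdiv hO hI

omit [IsQuaternionAlgebra ℚ B] hdiv hO in
/-- The left order of an invertible right ideal is a `ℤ`-order. [folklore] -/
theorem IsInvertibleRightIdeal.isZOrder_leftOrderOf : IsZOrder (leftOrderOf I) := by
  haveI : IsAddTorsionFree B := isAddTorsionFree_of_charZero_module ℚ B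
  exact isZOrder_iff_isOrder.mpr (Brandt.isOrder_leftOrder hI.isFullLattice)

/-- **Local form of the connecting data**: at a prime `q`, `I_(q) = α O_(q)` and
`O_ℓ(I)_(q) = α O_(q) α⁻¹`. [cite: Voight2021, Main Thm. 16.6.1] -/
theorem IsInvertibleRightIdeal.exists_localAt_leftOrderOf (q : ℕ) [Fact q.Prime] :
    ∃ α : Bˣ, localAt q I = α • localAt q O ∧
      localAt q (leftOrderOf I) = α • (MulOpposite.op ((α⁻¹ : Bˣ) : B) • localAt q O) := by
  obtain ⟨α, -, hα⟩ := hI.exists_localAt_eq_units_smul hdiv hO q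
  refine ⟨α, hα, ?_⟩
  rw [← leftOrderOf_localAt q hI.isFullLattice.1, hα, leftOrderOf_units_smul, hO.leftOrderOf_localAt_eq]

omit [Algebra ℚ B] [IsQuaternionAlgebra ℚ B] hdiv in
/-- **Local form of the transport**: if `J_(q) = β O_(q)` and `I_(q) = α O_(q)` then
`((J : I)_ℓ)_(q) = (β α⁻¹) O_ℓ(I)_(q)`. [folklore] -/
theorem localAt_transporterLeft_eq {J : Submodule ℤ B} {q : ℕ} [Fact q.Prime] {α β : Bˣ}
    (hα : localAt q I = α • localAt q O) (hβ : localAt q J = β • localAt q O) :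
    localAt q (transporterLeft I J) = (β * α⁻¹) • localAt q (leftOrderOf I) := by
  rw [← transporterLeft_localAt q hI.isFullLattice.1, hα, hβ,
    transporterLeft_units_smul_units_smul (le_localAt q O hO.one_mem)
      (fun a ha b hb => mul_mem_localAt hO.mul_mem q ha hb),
    ← leftOrderOf_localAt q hI.isFullLattice.1, hα, leftOrderOf_units_smul,
    hO.leftOrderOf_localAt_eq, mul_smul, inv_smul_smul]

/-- **`(J : I)_ℓ` is an invertible right `O_ℓ(I)`-ideal** for every invertible right `O`-ideal
`J` (locally principal: `(β_q α_q⁻¹) O'_(q)`). [cite: VignerasLNM800, Ch. I §4 (ordres liés)] -/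
theorem isInvertibleRightIdeal_transporterLeft {J : Submodule ℤ B} (hJ : IsInvertibleRightIdeal O J) :
    IsInvertibleRightIdeal (leftOrderOf I) (transporterLeft I J) := by
  have hO' := hI.isZOrder_leftOrderOf
  haveI : IsAddTorsionFree B := isAddTorsionFree_of_charZero_module ℚ B
  -- `n • J ⊆ (J : I)_ℓ ⊆ J i₀⁻¹` for `n` with `n I ⊆ O` and a unit `i₀ ∈ I`
  obtain ⟨n, hn, hnI⟩ := exists_smul_mem_of_fg hO.isFullLattice hI.isFullLattice.1
  have hsub : ∀ x ∈ J, n • x ∈ transporterLeft I J := fun x hx m hm => by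
    rw [smul_mul_assoc, ← mul_smul_comm]
    exact hJ.mul_mem hx (hnI m hm)
  obtain ⟨i₀, hi₀I, -⟩ := hI.exists_localAt_eq_units_smul hdiv hO 2
  have hsup : transporterLeft I J ≤ MulOpposite.op ((i₀⁻¹ : Bˣ) : B) • J := fun x hx => by
    rw [mem_op_units_smul_submodule_iff, inv_inv]
    exact hx _ hi₀I
  have hfull : IsFullLattice B (transporterLeft I J) := by
    refine ⟨Submodule.FG.of_le ?_ hsup, fun d => ?_⟩
    · rw [Submodule.pointwise_smul_def]
      exact hJ.isFullLattice.1.map _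
    · obtain ⟨m, hm, hmd⟩ := hJ.isFullLattice.2 d
      exact ⟨n * m, mul_ne_zero hn hm, by rw [mul_smul]; exact hsub _ hmd⟩
  refine IsInvertibleRightIdeal.of_forall_localAt_eq_units_smul hO' hfull fun q hq => ?_
  haveI : Fact q.Prime := ⟨hq⟩
  obtain ⟨α, -, hα⟩ := hI.exists_localAt_eq_units_smul hdiv hO q
  obtain ⟨β, -, hβ⟩ := hJ.exists_localAt_eq_units_smul hdiv hO q
  exact ⟨β * α⁻¹, localAt_transporterLeft_eq hO hI hα hβ⟩

/-- **`(J : I)_ℓ I = J`.** [folklore] -/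
theorem transporterLeft_mul_eq {J : Submodule ℤ B} (hJ : IsInvertibleRightIdeal O J) :
    transporterLeft I J * I = J := by
  refine eq_iff_forall_prime_localAt_eq.mpr fun q hq => ?_
  haveI : Fact q.Prime := ⟨hq⟩
  obtain ⟨α, hα, hO'⟩ := hI.exists_localAt_leftOrderOf hdiv hO q
  obtain ⟨β, -, hβ⟩ := hJ.exists_localAt_eq_units_smul hdiv hO q
  rw [← localAt_mul_localAt_eq, localAt_transporterLeft_eq hO hI hα hβ, hO', hα, hβ,
    units_smul_conj_mul_units_smul (hO.localAt_mul_localAt q), inv_mul_cancel_right]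

/-- **`J' I` is an invertible right `O`-ideal** for every invertible right `O_ℓ(I)`-ideal `J'`
(locally `(β' α) O_(q)`). [cite: VignerasLNM800, Ch. I §4 (ordres liés)] -/
theorem IsInvertibleRightIdeal.mul_connecting {J' : Submodule ℤ B}
    (hJ' : IsInvertibleRightIdeal (leftOrderOf I) J') : IsInvertibleRightIdeal O (J' * I) := by
  have hO' := hI.isZOrder_leftOrderOf
  have hfull : IsFullLattice B (J' * I) := by
    refine ⟨hJ'.isFullLattice.1.mul hI.isFullLattice.1, fun d => ?_⟩
    -- `J'` contains a unit `j₀`; `n (j₀⁻¹ d) ∈ I` for some `n`; then `n d = j₀ (n j₀⁻¹ d) ∈ J' I`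
    obtain ⟨j₀, hj₀, -⟩ := hJ'.exists_localAt_eq_units_smul hdiv hO' 2
    obtain ⟨n, hn, hnd⟩ := hI.isFullLattice.2 (((j₀⁻¹ : Bˣ) : B) * d)
    refine ⟨n, hn, ?_⟩
    have : n • d = (j₀ : B) * (n • (((j₀⁻¹ : Bˣ) : B) * d)) := by
      rw [mul_smul_comm, ← mul_assoc, Units.mul_inv, one_mul]
    rw [this]
    exact Submodule.mul_mem_mul hj₀ hnd
  refine IsInvertibleRightIdeal.of_forall_localAt_eq_units_smul hO hfull fun q hq => ?_
  haveI : Fact q.Prime := ⟨hq⟩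
  obtain ⟨α, hα, hO'q⟩ := hI.exists_localAt_leftOrderOf hdiv hO q
  obtain ⟨β', -, hβ'⟩ := hJ'.exists_localAt_eq_units_smul hdiv hO' q
  refine ⟨β' * α, ?_⟩
  rw [← localAt_mul_localAt_eq, hβ', hO'q, hα, units_smul_conj_mul_units_smul (hO.localAt_mul_localAt q)]

/-- **`((J' I) : I)_ℓ = J'`.** [folklore] -/
theorem transporterLeft_mul_self {J' : Submodule ℤ B}
    (hJ' : IsInvertibleRightIdeal (leftOrderOf I) J') : transporterLeft I (J' * I) = J' := by
  have hO' := hI.isZOrder_leftOrderOf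
  refine eq_iff_forall_prime_localAt_eq.mpr fun q hq => ?_
  haveI : Fact q.Prime := ⟨hq⟩
  obtain ⟨α, hα, hO'q⟩ := hI.exists_localAt_leftOrderOf hdiv hO q
  obtain ⟨β', -, hβ'⟩ := hJ'.exists_localAt_eq_units_smul hdiv hO' q
  have hJI : localAt q (J' * I) = (β' * α) • localAt q O := by
    rw [← localAt_mul_localAt_eq, hβ', hO'q, hα, units_smul_conj_mul_units_smul (hO.localAt_mul_localAt q)]
  rw [localAt_transporterLeft_eq hO hI hα hJI, mul_inv_cancel_right, hβ']

/-- **The transport preserves indices**: `[(J : I)_ℓ : (M : I)_ℓ] = [J : M]` for invertible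
right `O`-ideals `M ⊆ J` (locally both sides are translates by `α_q⁻¹` on the right). [folklore] -/
theorem relIndex_transporterLeft {J M : Submodule ℤ B} (hJ : IsInvertibleRightIdeal O J)
    (hM : IsInvertibleRightIdeal O M) (hle : M ≤ J) :
    (transporterLeft I M).toAddSubgroup.relIndex (transporterLeft I J).toAddSubgroup =
      M.toAddSubgroup.relIndex J.toAddSubgroup := by
  haveI : IsAddTorsionFree B := isAddTorsionFree_of_charZero_module ℚ B
  have hle' : transporterLeft I M ≤ transporterLeft I J := fun x hx m hm => hle (hx m hm)
  have hn : M.toAddSubgroup.relIndex J.toAddSubgroup ≠ 0 :=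
    relIndex_ne_zero_of_isFullLattice hM.isFullLattice hJ.isFullLattice.1
  have hn' : (transporterLeft I M).toAddSubgroup.relIndex (transporterLeft I J).toAddSubgroup ≠ 0 :=
    relIndex_ne_zero_of_isFullLattice (isInvertibleRightIdeal_transporterLeft hdiv hO hI hM).isFullLattice
      (isInvertibleRightIdeal_transporterLeft hdiv hO hI hJ).isFullLattice.1
  -- compare the local indices at every prime
  have hloc : ∀ q : ℕ, q.Prime →
      (localAt q (transporterLeft I M)).toAddSubgroup.relIndex (localAt q (transporterLeft I J)).toAddSubgroup =
        (localAt q M).toAddSubgroup.relIndex (localAt q J).toAddSubgroup := fun q hq => by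
    haveI : Fact q.Prime := ⟨hq⟩
    obtain ⟨α, -, hα⟩ := hI.exists_localAt_eq_units_smul hdiv hO q
    obtain ⟨β, -, hβ⟩ := hJ.exists_localAt_eq_units_smul hdiv hO q
    obtain ⟨γ, -, hγ⟩ := hM.exists_localAt_eq_units_smul hdiv hO q
    obtain ⟨_, _, hO'⟩ := hI.exists_localAt_leftOrderOf hdiv hO q
    rw [localAt_transporterLeft_eq hO hI hα hβ, localAt_transporterLeft_eq hO hI hα hγ,
      ← leftOrderOf_localAt q hI.isFullLattice.1, hα, leftOrderOf_units_smul, hO.leftOrderOf_localAt_eq,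
      mul_smul, mul_smul, inv_smul_smul, units_smul_op_smul_comm,
      units_smul_op_smul_comm, ← hβ, ← hγ, relIndex_op_smul]
  -- the global indices are determined by the local ones
  have key : ∀ q : ℕ, q.Prime →
      ((localAt q (transporterLeft I M)).toAddSubgroup.relIndex (localAt q (transporterLeft I J)).toAddSubgroup =
        q ^ ((transporterLeft I M).toAddSubgroup.relIndex (transporterLeft I J).toAddSubgroup).factorization q) ∧
      ((localAt q M).toAddSubgroup.relIndex (localAt q J).toAddSubgroup =
        q ^ (M.toAddSubgroup.relIndex J.toAddSubgroup).factorization q) := fun q hq => by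
    haveI : Fact q.Prime := ⟨hq⟩
    exact ⟨relIndex_localAt _ _ hle' hn', relIndex_localAt _ _ hle hn⟩
  -- so the two indices have the same factorisation
  have hfac : ((transporterLeft I M).toAddSubgroup.relIndex (transporterLeft I J).toAddSubgroup).factorization =
      (M.toAddSubgroup.relIndex J.toAddSubgroup).factorization := by
    ext q
    by_cases hq : q.Prime
    · have h1 := (key q hq).1
      have h2 := (key q hq).2
      rw [hloc q hq] at h1
      rw [h1] at h2
      exact Nat.pow_right_injective hq.two_le h2
    · rw [Nat.factorization_eq_zero_of_not_prime _ hq, Nat.factorization_eq_zero_of_not_prime _ hq]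
  exact Nat.eq_of_factorization_eq hn' hn fun q => by rw [hfac]
where
  /-- Right translation preserves indices of lattices. -/
  relIndex_op_smul {c : Bˣ} {M' J' : Submodule ℤ B} :
      (MulOpposite.op ((c : B)) • M').toAddSubgroup.relIndex (MulOpposite.op ((c : B)) • J').toAddSubgroup =
        M'.toAddSubgroup.relIndex J'.toAddSubgroup := by
    rw [Submodule.pointwise_smul_toAddSubgroup, Submodule.pointwise_smul_toAddSubgroup,
      AddSubgroup.pointwise_smul_def, AddSubgroup.pointwise_smul_def]
    refine AddSubgroup.relIndex_map_map_of_injective _ _ fun x y hxy => ?_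
    have hxy' : x * (c : B) = y * (c : B) := by
      simpa [MulOpposite.smul_eq_mul_unop] using hxy
    exact (Units.mul_left_inj c).mp hxy'


/-! ### Injectivity, stabilisers, classes -/

/-- The transport is injective on invertible right ideals (`J = (J : I)_ℓ I`). [folklore] -/
theorem transporterLeft_injective {J₁ J₂ : Submodule ℤ B} (h₁ : IsInvertibleRightIdeal O J₁)
    (h₂ : IsInvertibleRightIdeal O J₂) (h : transporterLeft I J₁ = transporterLeft I J₂) : J₁ = J₂ := by
  rw [← transporterLeft_mul_eq hdiv hO hI h₁, ← transporterLeft_mul_eq hdiv hO hI h₂, h]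

/-- **The transport preserves stabilisers**: `Stab_{Bˣ}((J : I)_ℓ) = Stab_{Bˣ}(J)`, so the
weights `|O_ℓ(·)ˣ| / 2` agree. [folklore] -/
theorem stabilizer_transporterLeft {J : Submodule ℤ B} (hJ : IsInvertibleRightIdeal O J) :
    MulAction.stabilizer Bˣ (transporterLeft I J) = MulAction.stabilizer Bˣ J := by
  ext b
  rw [MulAction.mem_stabilizer_iff, MulAction.mem_stabilizer_iff, ← transporterLeft_units_smul]
  exact ⟨fun h => transporterLeft_injective hdiv hO hI (hJ.units_smul b) hJ h, fun h => by rw [h]⟩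

/-- Classes correspond: `[(J₂ : I)_ℓ] = [(J₁ : I)_ℓ] ↔ [J₂] = [J₁]`. [folklore] -/
theorem mk_transporterLeft_eq_iff {J₁ J₂ : invertibleRightIdeals O} :
    RightIdealClass.mk (⟨transporterLeft I J₁, isInvertibleRightIdeal_transporterLeft hdiv hO hI J₁.2⟩ :
        invertibleRightIdeals (leftOrderOf I)) =
      RightIdealClass.mk ⟨transporterLeft I J₂, isInvertibleRightIdeal_transporterLeft hdiv hO hI J₂.2⟩ ↔
    RightIdealClass.mk J₁ = RightIdealClass.mk J₂ := by
  rw [RightIdealClass.mk_eq_mk_iff, RightIdealClass.mk_eq_mk_iff]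
  refine ⟨fun ⟨b, hb⟩ => ⟨b, ?_⟩, fun ⟨b, hb⟩ => ⟨b, ?_⟩⟩
  · dsimp only at hb
    rw [← transporterLeft_units_smul] at hb
    exact transporterLeft_injective hdiv hO hI J₂.2 (J₁.2.units_smul b) hb
  · dsimp only
    rw [hb, transporterLeft_units_smul]

/-! ### The Brandt data agree -/

/-- **Sub-ideal counts agree under the transport**:
`B_{[J] [K]}(n)` computed on `J` for `O` equals `B_{[(J:I)_ℓ] [(K:I)_ℓ]}(n)` for `O_ℓ(I)`
(`M ↦ (M : I)_ℓ`, with inverse `M' ↦ M' I`, is a bijection of the sets counted, preserving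
inclusion, index and class). [cite: VignerasLNM800, Ch. III §5 B] -/
theorem subidealCount_transporterLeft (J K : invertibleRightIdeals O) (n : ℕ) :
    subidealCount (leftOrderOf I) (transporterLeft I J) n
        (RightIdealClass.mk ⟨transporterLeft I K, isInvertibleRightIdeal_transporterLeft hdiv hO hI K.2⟩) =
      subidealCount O J n (RightIdealClass.mk K) := by
  unfold subidealCount
  refine Nat.card_congr ?_
  refine
    { toFun := fun M => ⟨⟨(M.1 : Submodule ℤ B) * I, IsInvertibleRightIdeal.mul_connecting hdiv hO hI M.1.2⟩,
        ?_, ?_, ?_⟩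
      invFun := fun M => ⟨⟨transporterLeft I M.1, isInvertibleRightIdeal_transporterLeft hdiv hO hI M.1.2⟩,
        ?_, ?_, ?_⟩
      left_inv := fun M => Subtype.ext (Subtype.ext (transporterLeft_mul_self hdiv hO hI M.1.2))
      right_inv := fun M => Subtype.ext (Subtype.ext (transporterLeft_mul_eq hdiv hO hI M.1.2)) }
  · -- `M' I ⊆ (J:I)_ℓ I = J`
    calc (M.1 : Submodule ℤ B) * I ≤ transporterLeft I J * I := mul_le_mul' M.2.1 le_rfl
      _ = J := transporterLeft_mul_eq hdiv hO hI J.2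
  · -- index: `[J : M' I] = [(J:I)_ℓ : M']`
    have hMI : IsInvertibleRightIdeal O ((M.1 : Submodule ℤ B) * I) :=
      IsInvertibleRightIdeal.mul_connecting hdiv hO hI M.1.2
    have hle : (M.1 : Submodule ℤ B) * I ≤ J := by
      calc (M.1 : Submodule ℤ B) * I ≤ transporterLeft I J * I := mul_le_mul' M.2.1 le_rfl
        _ = J := transporterLeft_mul_eq hdiv hO hI J.2
    rw [← relIndex_transporterLeft hdiv hO hI J.2 hMI hle, transporterLeft_mul_self hdiv hO hI M.1.2]
    exact M.2.2.1
  · -- class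
    have h := M.2.2.2
    have hT : transporterLeft I ((M.1 : Submodule ℤ B) * I) = M.1 := transporterLeft_mul_self hdiv hO hI M.1.2
    refine (mk_transporterLeft_eq_iff hdiv hO hI
      (J₁ := ⟨(M.1 : Submodule ℤ B) * I, IsInvertibleRightIdeal.mul_connecting hdiv hO hI M.1.2⟩) (J₂ := K)).mp ?_
    refine Eq.trans ?_ h
    congr 1
    exact Subtype.ext hT
  · exact fun x hx m hm => M.2.1 (hx m hm)
  · rw [relIndex_transporterLeft hdiv hO hI J.2 M.1.2 M.2.1]
    exact M.2.2.1
  · rw [mk_transporterLeft_eq_iff hdiv hO hI]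
    exact M.2.2.2

/-- **The Brandt data of connected orders agree** (Vignéras III §5 B–C; Eichler 1973 II §6:
the Brandt matrices depend only on the genus of the order). For a `ℤ`-order `O` of a division
quaternion algebra over `ℚ` and an invertible right `O`-ideal `I` with left order `O' = O_ℓ(I)`,
there is a bijection `e : Cls O ≃ Cls O'` (induced by `J ↦ (J : I)_ℓ`) with
`w'_{e i} = w_i` and `B'(n)_{e i, e j} = B(n)_{i j}` for all `n, i, j`. [cite: VignerasLNM800, Ch. III §5 B] -/
theorem BrandtData.ofOrder_transport :
    ∃ e : RightIdealClass O ≃ RightIdealClass (leftOrderOf I),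
      (∀ J : invertibleRightIdeals O, e (RightIdealClass.mk J) =
        RightIdealClass.mk ⟨transporterLeft I J, isInvertibleRightIdeal_transporterLeft hdiv hO hI J.2⟩) ∧
      (∀ i, (BrandtData.ofOrder (leftOrderOf I) hI.isZOrder_leftOrderOf).w (e i) =
        (BrandtData.ofOrder O hO).w i) ∧
      ∀ n i j, (BrandtData.ofOrder (leftOrderOf I) hI.isZOrder_leftOrderOf).T n (e i) (e j) =
        (BrandtData.ofOrder O hO).T n i j := by
  have hO' := hI.isZOrder_leftOrderOf
  -- the map on classes
  let f : RightIdealClass O → RightIdealClass (leftOrderOf I) :=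
    Quotient.map' (fun J : invertibleRightIdeals O =>
      (⟨transporterLeft I J, isInvertibleRightIdeal_transporterLeft hdiv hO hI J.2⟩ :
        invertibleRightIdeals (leftOrderOf I)))
      (fun J₁ J₂ ⟨b, hb⟩ => ⟨b, by dsimp only; rw [hb, transporterLeft_units_smul]⟩)
  have hf : ∀ J : invertibleRightIdeals O, f (RightIdealClass.mk J) =
      RightIdealClass.mk ⟨transporterLeft I J, isInvertibleRightIdeal_transporterLeft hdiv hO hI J.2⟩ :=
    fun J => rfl
  have hinj : Function.Injective f := by
    intro i j hij
    obtain ⟨J₁, rfl⟩ := RightIdealClass.mk_surjective i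
    obtain ⟨J₂, rfl⟩ := RightIdealClass.mk_surjective j
    rw [hf, hf] at hij
    exact (mk_transporterLeft_eq_iff hdiv hO hI).mp hij
  have hsurj : Function.Surjective f := by
    intro j
    obtain ⟨J', rfl⟩ := RightIdealClass.mk_surjective j
    refine ⟨RightIdealClass.mk ⟨(J' : Submodule ℤ B) * I, IsInvertibleRightIdeal.mul_connecting hdiv hO hI J'.2⟩, ?_⟩
    rw [hf]
    congr 1
    exact Subtype.ext (transporterLeft_mul_self hdiv hO hI J'.2)
  refine ⟨Equiv.ofBijective f ⟨hinj, hsurj⟩, fun J => hf J, fun i => ?_, fun n i j => ?_⟩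
  · obtain ⟨J, rfl⟩ := RightIdealClass.mk_surjective i
    rw [Equiv.ofBijective_apply, hf, BrandtData.ofOrder_w_mk, BrandtData.ofOrder_w_mk,
      stabilizer_transporterLeft hdiv hO hI J.2]
  · obtain ⟨J, rfl⟩ := RightIdealClass.mk_surjective i
    obtain ⟨K, rfl⟩ := RightIdealClass.mk_surjective j
    rw [Equiv.ofBijective_apply, Equiv.ofBijective_apply, hf, hf, BrandtData.ofOrder_T_mk,
      BrandtData.ofOrder_T_mk, subidealCount_transporterLeft hdiv hO hI]

end Transport

end Literature.NumberTheory.Automorphic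

end
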